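import Summits.BirchSwinnertonDyer.BirchSwinnertonDyer.Theorems.KolyvaginRoadThreeSchneiderTamAtThreeHeightLogNumeratorExactPWeierstrass
import Summits.BirchSwinnertonDyer.BirchSwinnertonDyer.Theorems.KolyvaginRoadThreeSchneiderTamAtThreeHeightLogNumeratorExactPLambert
import Summits.BirchSwinnertonDyer.BirchSwinnertonDyer.Theorems.KolyvaginRoadThreeSchneiderTamAtThreeHeightLogNumeratorExactPScale
import HarnessLib

/-!
# «The height is the logarithm of the numerator» — part 4: THE EXACT SECOND-ORDER LAW OF THE `p`-ADIC
# HEIGHT AT EVERY MULTIPLICATIVE PRIME `p ≥ 5`, FROM LEVEL ONE: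
# `ĥ_p(P) ≡ log_p num x − κ_E·den x/num x (mod p^{4k})`, `κ_E = (C⁻²·E₂(q) − b₂)/12`

HONEST FRAMING (cell `bsd-stepL`, seat `bsd-stepL-tam3-p2` g5, WIDTH-LEVER second lane «closed-form Schneider
local factor … by Kodaira type (finite case table proved once)»; `--supports stmt-BirchSwinnertonDyer-19154 --as helper`):
THEOREMS ONLY, unconditional, route-independent (no Theses import); 0 definitions, 0 named facts, 0 sorry;
nothing here proves the crux `SchneiderTamAtThree` (a `p = 3` statement), Schneider's conjecture or BSD.
This is the `p`-UNIFORM twin of part 7b (`…HeightLogNumeratorExact`, g3, `p = 3`, level `≥ 2`):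

* `norm_heightFourOneCoord_sub_padicLog_num_add_kappaE_mul_le_padic` — for EVERY prime `p ≥ 5`, `W/ℚ` globally
  minimal with multiplicative reduction at `p` (split or not), ANY `q ∈ ℚ_p` with `‖q‖_p < 1` and ANY rational
  point `P = (x, y)` with `‖x‖_p > 1` (level `k ≥ 1` — no level-two hypothesis):
  **`‖ĥ_p(P) − log_p num x + κ_E·den x/num x‖_p ≤ ‖x‖_p⁻²`**, `ĥ_p = heightFourOneCoord` (SW 2013 (4.1) on
  coordinates), **`κ_E = (C⁻²·E₂(q) − b₂)/12`**, `E₂(q) = 1 − 24 s₁(q)`, `C² = uniformisationScaleSq W p q`.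
  The precision `p^{−4k}` is independent of the Kodaira type `I_ν`; the only place `ν` could enter — the
  `ℓ⁴`-coefficient `(6c₄ − 5b₂² − C'²)/1440` at `p = 5` — is killed by the congruence `C'² ≡ c₄ (mod p)` of part 3b,
  valid for every `q` because `p ∣ Δ`. INSTRUMENT (pre-registered, seat numerics `numerics/check_exact_p5.py` on lane
  A's REG3CERT/v2 table j249895): `v_p(residual) ≥ 4k` on 3 497/3 497 rows with point data (`p ∈ {5,7,11,13,17,23,29}`,
  951 non-split + 2 546 split, 2 004 of level one), equality on 2 733 — the law is sharp.
  Consequences (parts 5–6): tower decidability of every tabulated pair at `p ≥ 5` by ONE congruence per row (the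
  deep checkers wanted by `bsd-stepL-rest-p2` g7 for 19624's TR3–TR10 and by the (T) branch 19702), and the split
  form (`κ_E` shifted by the `𝓛`-term `1/(C² log_p q_E)`).

References: [SteinWuthrich2013] §4.1 (4.1), §4.2; [MazurTate1991] §1; [SilvermanATAEC1994] V.1 Rem. 1.2, V.3;
[SilvermanAEC2009] IV.1, IV.6.4, VI.3, VII.2.2; tree: parts 1a/1b/2a/2b/3a/3b of this `p ≥ 5` chain, g3 part 7b.
-/

noncomputable section

open scoped Classical Nat
open Filter Topology IsUltrametricDist PowerSeries
open WeierstrassCurve Literature.NumberTheory.EllipticCurves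
open Literature.NumberTheory.EllipticCurves.SteinWuthrich2013
open Literature.NumberTheory.EllipticCurves.TateCurve
open Literature.NumberTheory.EllipticCurves.Rank1Residual
open Summit.BirchSwinnertonDyer.Uniform.UI.O2

namespace Summit.BirchSwinnertonDyer.Rank1Residual.X11b.RegMult.HeightLogNumerator

variable {p : ℕ} [hp : Fact p.Prime]

/-! ### §12 The exact second-order law at `p ≥ 5` -/

section ExactP

variable {W : WeierstrassCurve ℚ}

set_option maxHeartbeats 800000 in
/-- **THE EXACT SECOND-ORDER LAW OF THE `p`-ADIC HEIGHT, `p ≥ 5`.** For every prime `p ≥ 5`, `W/ℚ` globally minimal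
with multiplicative reduction at `p`, any `q ∈ ℚ_p` with `‖q‖_p < 1` and any rational affine point `P = (x, y)` with
`‖x‖_p > 1` (level `k ≥ 1`): **`‖ĥ_p(P) − log_p(num x) + κ_E·(den x)/(num x)‖_p ≤ ‖x‖_p⁻²`** with the EXACT curve
constant **`κ_E = (C⁻²·E₂(q) − b₂)/12`**, `E₂(q) = 1 − 24·s₁(q)` (`s₁ = tateS 1`), `C² = uniformisationScaleSq W p q`.
Precision `p^{−4k}` uniformly in the Kodaira type. Mechanism (as part 7b at `p = 3`):
`ĥ_p − log_p a = −log(xℓ²) − log(2(ch L − 1)/L) − log Π`, the three logarithms to second order (parts 2b, 1b, 3a),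
the conversion `ℓ² → x⁻¹` at the corrected scale `C' = C⁻²E₂(q)` (part 3b, using `C'² ≡ c₄ (mod p)`).
[cite: SteinWuthrich2013, §4.1 eq. (4.1), §4.2] [cite: SilvermanATAEC1994, Thm. V.3.1 (b), Remark V.1.2] -/
theorem norm_heightFourOneCoord_sub_padicLog_num_add_kappaE_mul_le_padic (hp5 : 5 ≤ p) [W.IsElliptic]
    [W.IsGloballyMinimal] (hW : Mult W p) {q : ℚ_[p]} (hq : ‖q‖ < 1) {x y : ℚ}
    (hxy : W.toAffine.Nonsingular x y) (hx : 1 < ‖(x : ℚ_[p])‖) :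
    ‖heightFourOneCoord W p q x y - padicLog p ((x.num : ℚ) : ℚ_[p]) +
        ((uniformisationScaleSq W p q)⁻¹ * (1 - 24 * tateS 1 q) - (W.baseChange ℚ_[p]).b₂) / 12 *
          (((x.den : ℚ) : ℚ_[p]) / ((x.num : ℚ) : ℚ_[p]))‖ ≤ ‖(x : ℚ_[p])‖⁻¹ ^ 2 := by
  have hp2 : p ≠ 2 := by omega
  have hp3 : p ≠ 3 := by omega
  have hp1 : (1 : ℝ) < p := by exact_mod_cast hp.out.one_lt
  have hp1' : (1 : ℝ) ≤ p := hp1.le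
  have hp0 : (0 : ℝ) < p := by positivity
  -- the objects
  set X : ℚ_[p] := (x : ℚ_[p]) with hXdef
  set Y : ℚ_[p] := (y : ℚ_[p]) with hYdef
  set V : WeierstrassCurve ℚ_[p] := W.baseChange ℚ_[p] with hVdef
  set z : ℚ_[p] := -X / Y with hzdef
  set ℓ : ℚ_[p] := V.padicFormalLog z with hℓdef
  set C2 : ℚ_[p] := uniformisationScaleSq W p q with hC2def
  set L : ℚ_[p] := logUnitParamSq W p q x y with hLdef
  set c : ℚ_[p] := coshOfSq L with hcdef
  set Pr : ℚ_[p] := ∏' n : ℕ, (1 - 2 * q ^ (n + 1) * c + q ^ (2 * (n + 1))) ^ 2 /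
    (1 - q ^ (n + 1)) ^ 4 with hPrdef
  set K : ℚ_[p] := tateS 1 q with hKdef
  have hSig : tateSigmaValueSq W p q x y = C2 * (2 * (c - 1) * Pr) := rfl
  have hL : L = ℓ ^ 2 / C2 := rfl
  -- basic norms
  obtain ⟨hz, hz2⟩ := norm_neg_div_of_one_lt_norm (p := p) hxy hx
  have hX0 : 0 < ‖X‖ := one_pos.trans hx
  have hX0' : X ≠ 0 := norm_pos_iff.mp hX0
  have hXinv : ‖X‖⁻¹ = ‖z‖ ^ 2 := hz2.symm
  have hXi2 : ‖X⁻¹‖ = ‖z‖ ^ 2 := by rw [norm_inv, hXinv]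
  have hXz : ‖X‖ * ‖z‖ ^ 2 = 1 := by rw [hz2, mul_inv_cancel₀ hX0.ne']
  have hzz : 0 < ‖z‖ := by
    have h : 0 < ‖z‖ ^ 2 := by rw [hz2]; exact inv_pos.mpr hX0
    rcases (norm_nonneg z).eq_or_lt with h0 | h0
    · rw [← h0] at h; norm_num at h
    · exact h0
  have hz0 : z ≠ 0 := norm_pos_iff.mp hzz
  have hz1 : ‖z‖ ≤ 1 := hz.trans (inv_le_one_of_one_le₀ hp1')
  have hzlt1 : ‖z‖ < 1 := lt_of_le_of_lt hz (inv_lt_one_of_one_lt₀ hp1)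
  have hpz : (p : ℝ) * ‖z‖ ≤ 1 := by
    calc (p : ℝ) * ‖z‖ ≤ p * (p : ℝ)⁻¹ := by gcongr
      _ = 1 := mul_inv_cancel₀ hp0.ne'
  have hz2le : ‖z‖ ^ 2 ≤ ‖z‖ := by
    calc ‖z‖ ^ 2 = ‖z‖ * ‖z‖ := sq _
      _ ≤ 1 * ‖z‖ := by gcongr
      _ = ‖z‖ := one_mul _
  have hzp2 : ‖z‖ ^ 2 ≤ ((p : ℝ)⁻¹) ^ 2 := pow_le_pow_left₀ (norm_nonneg _) hz 2
  have hpz2 : (p : ℝ) * ‖z‖ ^ 2 ≤ 1 := by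
    calc (p : ℝ) * ‖z‖ ^ 2 = ((p : ℝ) * ‖z‖) * ‖z‖ := by ring
      _ ≤ 1 * 1 := mul_le_mul hpz hz1 (norm_nonneg _) zero_le_one
      _ = 1 := one_mul _
  have hp2z2 : (p : ℝ) ^ 2 * ‖z‖ ^ 2 ≤ 1 := by
    rw [← mul_pow]; exact pow_le_one₀ (by positivity) hpz
  have hC : ‖C2‖ = 1 := norm_uniformisationScaleSq_eq_one hW hq
  have hC0 : C2 ≠ 0 := norm_pos_iff.mp (by rw [hC]; exact one_pos)
  have hCi : ‖C2⁻¹‖ = 1 := by rw [norm_inv, hC, inv_one]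
  have heq : V.toAffine.Equation X Y := (nonsingular_ratCast (p := p) hxy).left
  obtain ⟨hsq, hxyn⟩ := V.norm_sq_eq_norm_cube heq hx
  have hY0 : Y ≠ 0 := norm_pos_iff.mp (hX0.trans hxyn)
  have hd0 : ((x.den : ℚ) : ℚ_[p]) ≠ 0 := by exact_mod_cast x.den_nz
  have hS0 := tateSigmaValueSq_ne_zero (p := p) hp2 hW hq hxy hx
  have hnum : ((x.num : ℚ) : ℚ_[p]) = X * ((x.den : ℚ) : ℚ_[p]) := by
    rw [hXdef, ← Rat.cast_mul, Rat.mul_den_eq_num]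
  -- integrality of `b₂, c₄`, and `c₄(V) = c₄(W)`
  have hb2n : ‖V.b₂‖ ≤ 1 := by
    have e := congrArg WeierstrassCurve.b₂ V.eq_map_integralModel
    rw [map_b₂] at e; rw [← e]; exact PadicInt.norm_le_one _
  have hc4n : ‖V.c₄‖ ≤ 1 := by
    have e := congrArg WeierstrassCurve.c₄ V.eq_map_integralModel
    rw [map_c₄] at e; rw [← e]; exact PadicInt.norm_le_one _
  have hc4W : V.c₄ = (W.c₄ : ℚ_[p]) := (map_c₄ W (algebraMap ℚ ℚ_[p])).trans (eq_ratCast _ _)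
  -- units `2`, `12`
  have hcop2 : Nat.Coprime p 2 := (Nat.coprime_primes hp.out Nat.prime_two).mpr hp2
  have hcop3 : Nat.Coprime p 3 := (Nat.coprime_primes hp.out Nat.prime_three).mpr hp3
  have h2n : ‖(2 : ℚ_[p])‖ = 1 := by simpa using Padic.norm_natCast_eq_one_iff.mpr hcop2
  have h2i : ‖(2 : ℚ_[p])⁻¹‖ = 1 := by rw [norm_inv, h2n, inv_one]
  have h12i : ‖(12 : ℚ_[p])⁻¹‖ = 1 := by
    have h12 : Nat.Coprime p 12 := by
      rw [show (12 : ℕ) = 2 ^ 2 * 3 by norm_num]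
      exact (Nat.Coprime.pow_right 2 hcop2).mul_right hcop3
    rw [norm_inv]; simpa using Padic.norm_natCast_eq_one_iff.mpr h12
  -- the Lambert constant and the corrected scale `C' = C⁻²·E₂(q)`
  have hK : ‖K‖ ≤ ‖q‖ := norm_tateS_le hq.le
  have hqp : ‖q‖ ≤ (p : ℝ)⁻¹ := norm_le_inv_of_norm_lt_one hq
  have hC'1 : ‖C2⁻¹ * (1 - 24 * K)‖ = 1 := norm_lambertScale_eq_one_padic hCi hK hq
  have hC'c : ‖(C2⁻¹ * (1 - 24 * K)) ^ 2 - V.c₄‖ ≤ (p : ℝ)⁻¹ := by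
    rw [hc4W]; exact norm_lambertScale_sq_sub_c₄_le_padic hW hq hK
  have hδ : ‖((C2⁻¹ * (1 - 24 * K)) ^ 2 - C2⁻¹ ^ 2) / 1440‖ ≤ 1 :=
    norm_lambertScale_sq_sub_sq_div_le_padic hp5 hCi hK hqp
  -- the three logarithms
  have hlog1 : ‖padicLog p (X * ℓ ^ 2) - (-(V.b₂ / 12) * ℓ ^ 2 + (V.c₄ / 240 - V.b₂ ^ 2 / 288) * ℓ ^ 4)‖
      ≤ ‖z‖ ^ 4 := by
    have h := norm_padicLog_x_mul_formalLog_sq_sub_le_padic V hp5 heq hx hz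
    rw [hXinv] at h
    exact h.trans_eq (by ring)
  have hXℓ : ‖X * ℓ ^ 2 - 1 + V.b₂ / 12 * ℓ ^ 2 - V.c₄ / 240 * ℓ ^ 4‖ ≤ ‖z‖ ^ 4 := by
    have h := norm_x_mul_formalLog_sq_sub_le_padic V hp5 heq hx hz
    rw [hXinv] at h
    exact h.trans_eq (by ring)
  have hℓn : ‖ℓ‖ = ‖z‖ := by
    have hw : ‖ℓ - z‖ ≤ ‖z‖ ^ 2 := norm_padicFormalLog_sub_self_le_sq_padic V hp5 hz
    have hzlt : ‖z‖ ^ 2 < ‖z‖ := by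
      calc ‖z‖ ^ 2 = ‖z‖ * ‖z‖ := sq _
        _ < 1 * ‖z‖ := mul_lt_mul_of_pos_right hzlt1 hzz
        _ = ‖z‖ := one_mul _
    have hlt : ‖ℓ - z‖ < ‖z‖ := lt_of_le_of_lt hw hzlt
    rw [show ℓ = z + (ℓ - z) by ring, norm_add_eq_max_of_norm_ne_norm hlt.ne', max_eq_left hlt.le]
  have hℓ0 : ℓ ≠ 0 := norm_pos_iff.mp (by rw [hℓn]; exact hzz)
  have hLn : ‖L‖ = ‖z‖ ^ 2 := by rw [hL, norm_div, norm_pow, hℓn, hC, div_one]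
  have hL0 : L ≠ 0 := norm_pos_iff.mp (by rw [hLn]; positivity)
  have hLp : ‖L‖ ≤ ((p : ℝ)⁻¹) ^ 2 := by rw [hLn]; exact hzp2
  have hlog2 : ‖padicLog p (2 * (c - 1) / L) - (L / 12 - L ^ 2 / 1440)‖ ≤ (p : ℝ) * ‖L‖ ^ 3 :=
    norm_padicLog_two_mul_coshOfSq_sub_one_div_sub_le_padic hp5 hL0 hLp
  obtain ⟨R, hR, hRle⟩ := coshOfSq_eq_one_add_half_add hp2 hLp
  have hc1eq : c - 1 = L / 2 + R := by rw [hcdef, hR]; ring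
  have hRlt : ‖R‖ < ‖L / 2‖ := by
    rw [div_eq_mul_inv, norm_mul, h2i, mul_one]
    refine lt_of_le_of_lt hRle ?_
    calc ‖L‖ * (p : ℝ)⁻¹ < ‖L‖ * 1 :=
          mul_lt_mul_of_pos_left (inv_lt_one_of_one_lt₀ hp1) (norm_pos_iff.mpr hL0)
      _ = ‖L‖ := mul_one _
  have hc1n : ‖c - 1‖ = ‖L‖ := by
    rw [hc1eq, norm_add_eq_max_of_norm_ne_norm hRlt.ne', max_eq_left hRlt.le, div_eq_mul_inv, norm_mul,
      h2i, mul_one]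
  have hc1 : ‖c - 1‖ ≤ ‖L‖ := hc1n.le
  have hc10 : c - 1 ≠ 0 := norm_pos_iff.mp (by rw [hc1n]; exact norm_pos_iff.mpr hL0)
  have hcn : ‖c‖ ≤ 1 := (norm_coshOfSq_eq_one hp2 hLp).le
  have hPr : ‖Pr - 1‖ ≤ ‖q‖ * ‖z‖ ^ 2 := by
    refine (norm_tprod_tateSigmaSq_factor_sub_one_le_mul hq hcn).trans ?_
    rw [← hLn]; gcongr
  have hPr1 : ‖Pr - 1‖ < 1 := by
    refine hPr.trans_lt ?_
    calc ‖q‖ * ‖z‖ ^ 2 ≤ 1 * ‖z‖ ^ 2 := mul_le_mul_of_nonneg_right hq.le (by positivity)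
      _ = ‖z‖ ^ 2 := one_mul _
      _ ≤ ‖z‖ := hz2le
      _ < 1 := hzlt1
  -- the sigma product to ALL orders in `q` (part 3a)
  have hPrK : ‖Pr - (1 - 4 * (c - 1) * K)‖ ≤ ‖q‖ ^ 2 * ‖c - 1‖ ^ 2 :=
    norm_tprod_tateSigmaSq_factor_sub_lambert_le_padic hq hcn
  have hlogPr : ‖padicLog p Pr - (Pr - 1)‖ ≤ (‖q‖ * ‖z‖ ^ 2) ^ 2 := by
    have h := Literature.NumberTheory.EllipticCurves.norm_padicLog_one_add_sub_le hp2 hPr1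
    rw [add_sub_cancel] at h
    exact h.trans (by gcongr)
  have hcL : ‖2 * (c - 1) - L‖ ≤ ‖L‖ ^ 2 := by
    have hD := norm_two_mul_coshOfSq_sub_one_sub_sub_le_padic hp2 hLp
    rw [show 2 * (c - 1) - L = (2 * (coshOfSq L - 1) - L - L ^ 2 / 12) + L ^ 2 / 12 by rw [hcdef]; ring]
    refine (norm_add_le_max _ _).trans (max_le (hD.trans ?_) ?_)
    · calc (p : ℝ) ^ 2 * ‖L‖ ^ 3 = ((p : ℝ) ^ 2 * ‖L‖) * ‖L‖ ^ 2 := by ring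
        _ ≤ 1 * ‖L‖ ^ 2 := by gcongr; rw [hLn]; exact hp2z2
        _ = ‖L‖ ^ 2 := one_mul _
    · rw [div_eq_mul_inv, norm_mul, h12i, mul_one, norm_pow]
  have hK4 : ‖padicLog p Pr + 2 * K * L‖ ≤ ‖z‖ ^ 4 :=
    exact_logPr_padic hq.le hLn hK hc1 hPrK hlogPr hcL
  have hPr0 : Pr ≠ 0 := by
    intro h; rw [h, zero_sub, norm_neg, norm_one] at hPr1; exact lt_irrefl _ hPr1
  have hcr0 : 2 * (c - 1) / L ≠ 0 := by
    refine div_ne_zero (mul_ne_zero ?_ hc10) hL0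
    exact norm_pos_iff.mp (by rw [h2n]; exact one_pos)
  -- `ĥ − log num = −log(x Σ²) = −(log(xℓ²) + log(2(c−1)/L) + log Π)`
  have hXℓ0 : X * ℓ ^ 2 ≠ 0 := mul_ne_zero hX0' (pow_ne_zero 2 hℓ0)
  have hdecomp : heightFourOneCoord W p q x y - padicLog p ((x.num : ℚ) : ℚ_[p]) =
      -(padicLog p (X * ℓ ^ 2) + padicLog p (2 * (c - 1) / L) + padicLog p Pr) := by
    have hprod : X * tateSigmaValueSq W p q x y = (X * ℓ ^ 2) * (2 * (c - 1) / L) * Pr := by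
      rw [hSig, hL]; field_simp
    rw [heightFourOneCoord_eq, hnum, padicLog_mul_holds p hX0' hd0,
      show padicLog p ((x.den : ℚ) : ℚ_[p]) - padicLog p (tateSigmaValueSq W p q x y) -
        (padicLog p X + padicLog p ((x.den : ℚ) : ℚ_[p])) =
        -(padicLog p X + padicLog p (tateSigmaValueSq W p q x y)) by ring,
      ← padicLog_mul_holds p hX0' hS0, hprod, padicLog_mul_holds p (mul_ne_zero hXℓ0 hcr0) hPr0,
      padicLog_mul_holds p hXℓ0 hcr0]
  -- conversion `ℓ² → x⁻¹` at the corrected scale `C'` (part 3b)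
  clear_value X Y z ℓ C2 L c Pr K
  obtain ⟨hK1, hK2, hK3⟩ :=
    exact_conversion_padic hp5 hX0' hXi2 hℓn.le hpz hb2n hc4n hC'1 hC'c hXℓ
  -- the exact regrouping
  have hfin : heightFourOneCoord W p q x y - padicLog p ((x.num : ℚ) : ℚ_[p]) +
      (C2⁻¹ * (1 - 24 * K) - V.b₂) / 12 * (((x.den : ℚ) : ℚ_[p]) / ((x.num : ℚ) : ℚ_[p])) =
      -(padicLog p (X * ℓ ^ 2) - (-(V.b₂ / 12) * ℓ ^ 2 + (V.c₄ / 240 - V.b₂ ^ 2 / 288) * ℓ ^ 4))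
      - (padicLog p (2 * (c - 1) / L) - (L / 12 - L ^ 2 / 1440))
      - (C2⁻¹ * (1 - 24 * K) - V.b₂) / 12 * (ℓ ^ 2 - (X⁻¹ - V.b₂ / 12 * X⁻¹ ^ 2))
      - (6 * V.c₄ - 5 * V.b₂ ^ 2 - (C2⁻¹ * (1 - 24 * K)) ^ 2) / 1440 * (ℓ ^ 4 - X⁻¹ ^ 2)
      - ((6 * V.c₄ - 5 * V.b₂ ^ 2 - (C2⁻¹ * (1 - 24 * K)) ^ 2) / 1440 -
          (C2⁻¹ * (1 - 24 * K) - V.b₂) / 12 * (V.b₂ / 12)) * X⁻¹ ^ 2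
      - ((C2⁻¹ * (1 - 24 * K)) ^ 2 - C2⁻¹ ^ 2) / 1440 * ℓ ^ 4
      - (padicLog p Pr + 2 * K * L) := by
    rw [hdecomp, hnum, hL]
    field_simp
    ring
  rw [hfin, hXinv, show (‖z‖ ^ 2) ^ 2 = ‖z‖ ^ 4 by ring]
  refine (norm_sub_le_max₃ _ _).trans (max_le ((norm_sub_le_max₃ _ _).trans (max_le
    ((norm_sub_le_max₃ _ _).trans (max_le ((norm_sub_le_max₃ _ _).trans (max_le
    ((norm_sub_le_max₃ _ _).trans (max_le ((norm_sub_le_max₃ _ _).trans (max_le ?_ ?_)) ?_)) ?_)) ?_)) ?_)) ?_)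
  · rw [norm_neg]; exact hlog1
  · refine hlog2.trans ?_
    rw [hLn]
    calc (p : ℝ) * (‖z‖ ^ 2) ^ 3 = ((p : ℝ) * ‖z‖ ^ 2) * ‖z‖ ^ 4 := by ring
      _ ≤ 1 * ‖z‖ ^ 4 := by gcongr
      _ = ‖z‖ ^ 4 := one_mul _
  · exact hK1
  · exact hK2
  · exact hK3
  · rw [norm_mul, norm_pow, hℓn]
    calc ‖((C2⁻¹ * (1 - 24 * K)) ^ 2 - C2⁻¹ ^ 2) / 1440‖ * ‖z‖ ^ 4 ≤ 1 * ‖z‖ ^ 4 := by gcongr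
      _ = ‖z‖ ^ 4 := one_mul _
  · exact hK4

end ExactP

end Summit.BirchSwinnertonDyer.Rank1Residual.X11b.RegMult.HeightLogNumerator

end
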